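import Summits.NavierStokesRegularity.FluidComputer.PalasekTowerRegisterGlobalHeredity
import Summits.NavierStokesRegularity.FluidComputer.PalasekTowerStageUniqueness
import Literature.Analysis.FluidPDE.NSUnconditionalUniquenessHolds
import Literature.Analysis.FluidPDE.TaoFiniteEnergyLerayHopf
import Literature.Analysis.FluidPDE.ClassicalSolutionGlue
import Literature.Analysis.FluidPDE.IsometryInvariance
import Literature.Analysis.FluidPDE.LeraySeparationOfEnergyTools

/-!
# REGISTER v2.3′: the two halves of `EpisodeInductionG` at the generic levels are EXACTLY the crux there
# (silent-window uniqueness without W14; the BC3 split is lossless unconditionally)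

Cell `ns-blowup`, seat `ns-blowup-ecbridge-5` (g0); companion of
`PalasekTowerRegisterGlobalHeredity.lean` (p415576: the named halves `ContinuationEnvelope` /
`ReadoutFloors` of the planner's BC3 birth skeleton for the crux `EpisodeInductionG`, item
stmt-NavierStokesRegularity-19178, and the composition
`episodeInductionG_of_rung_envelope_floors`). LABEL: E–C typing (KERNEL bookkeeping; every
statement here is PROVED, no `Prop` is introduced). WHAT THIS IS NOT: not Navier–Stokes evidence —
no stage, tower or instance is constructed or claimed; nothing here asserts regularity or blow-up.

## What is proved

* §1 **Silent-window uniqueness, unconditionally.** Two finite-energy classical solutions of the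
  forced system on a closed slab `[0, T]` with the SAME force, which agree on `[0, t₂]` and whose
  force vanishes from a time `t₁ < t₂` on, agree on all of `[0, T]`
  (`velocity_eq_of_silent_force`). No named fact is used: on `[t₁, t₂]` the solution is an
  UNFORCED finite-energy classical solution, so Tao's Lemma 8.1 energy class (tree theorem
  `Literature.Analysis.FluidPDE.energyClass_of_finiteEnergy`, all inputs discharged) puts `∇u(t₀)`
  in `L²` at almost every `t₀ ∈ (t₁, t₂)`; restarting at such a `t₀` (the system is autonomous,
  `IsClassicalNSSolutionOn.comp_add_right`), Tao's unconditional uniqueness Cor. 11.4 in the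
  UNFORCED velocity form — a THEOREM of the tree, `tao_finite_energy_velocity_uniqueness_holds` —
  identifies the two continuations on `[t₀, T]`. (The forced twin W14
  `tao_unconditional_uniqueness_velocity_forced` is needed only when the comparison must start
  inside the forced window `[0, τ₁)`; the `k = 1` corner is recorded in
  `Stage.continuation_velocity_eq_of_forced`.)
* §2 For a QUIET schedule (`f ≡ 0` from `τ₁` on) and a stage at level `k ≥ 2`, any two
  finite-energy classical continuations of the stage past `τ_k` coincide
  (`Stage.continuation_velocity_eq`): the continuation the induction speaks about is pinned by the
  stage WITHOUT any uniqueness hypothesis — in particular `ReadoutFloors` (which quantifies over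
  every finite-energy continuation inside the ceiling) is not inhabitable by Galilean / pressure-wave
  relabellings of a continuation (refuter4 K52's announced probe), and its finite-energy clause is
  exactly what makes this so.
* §3 **The lower half follows from the crux, unconditionally**: `ReadoutFloors.of_heredityFrom_two :
  HeredityFrom 2 → ReadoutFloors`; hence `heredityFrom_two_iff_envelope_and_floors :
  HeredityFrom 2 ↔ ContinuationEnvelope ∧ ReadoutFloors` and
  `episodeInductionG_iff_rung_envelope_floors :
  EpisodeInductionG ↔ HeredityAtOne ∧ ContinuationEnvelope ∧ ReadoutFloors` — the planner's BC3
  split is LOSSLESS with no named-fact hypothesis: proving the two generic-level stubs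
  `continuation_envelope` + `readout_floors` IS proving the crux at every level `k ≥ 2`; they are
  halves of the open problem, not register bookkeeping.
* §4 **The lower half may be asked of ONE continuation**: if every registered stage at a generic
  level has SOME finite-energy classical continuation to `τ (k+1)` meeting the three floors of level
  `k + 1` (no ceiling asked), then `ReadoutFloors` holds (`ReadoutFloors.of_exists_continuation`) —
  by §2 the floors transfer to every finite-energy continuation. This is the cheaper signature for a
  support item on the lower half.
* §5 `Schedule.Rigid.window_mul_ceiling_sq`: the rigid growth window in units of the sup-norm scaling
  time `ν/(c₂Y_k)²` is `c₂² · 4bβ · log N_{k+1} · N_k^{β-2}` (≈ `1.55·10³` at `k = 2` on the wide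
  rates, unbounded in `k`) — the kernel form of WHY the upper half is not a local-existence statement.

References: T. Tao, *Localisation and compactness properties of the Navier–Stokes global regularity
problem*, Anal. PDE 6 (2013), Cor. 11.4, Lemma 8.1 [cite: Tao2011, Cor. 11.4]; S. Palasek,
arXiv:2605.13827 §4 [cite: Palasek2026ElementaryModel, §4].
-/

noncomputable section

namespace Summit.NavierStokesRegularity.FluidComputer.PalasekTowerClayBridge

open Set MeasureTheory Filter Topology Function Real
open scoped ENNReal ContDiff NNReal
open Literature.Analysis.FluidPDE
open Summit.NavierStokesRegularity.NavierStokesRegularity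

/-! ## §1 Silent-window uniqueness of finite-energy classical solutions (no named fact) -/

/-- If `∫⁻` of `g` over an interval `(a, b)`, `a < b`, is finite, then `g` is finite at some point of
the interval (a full-measure set of them, but one suffices here). [folklore] -/
theorem exists_mem_Ioo_lt_top_of_lintegral_lt_top {a b : ℝ} (hab : a < b) {g : ℝ → ℝ≥0∞}
    (h : ∫⁻ t in Ioo a b, g t < ⊤) : ∃ t ∈ Ioo a b, g t < ⊤ := by
  by_contra hne
  push Not at hne
  have hle : ∫⁻ _ in Ioo a b, (⊤ : ℝ≥0∞) ≤ ∫⁻ t in Ioo a b, g t :=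
    setLIntegral_mono' measurableSet_Ioo fun t ht => hne t ht
  have hvol : volume (Ioo a b) ≠ 0 := by
    rw [Real.volume_Ioo, Ne, ENNReal.ofReal_eq_zero, not_le]
    linarith
  rw [setLIntegral_const, ENNReal.top_mul hvol, top_le_iff] at hle
  exact absurd hle h.ne

/-- **Restarting a classical solution after the force falls silent.** A classical solution of the
forced system on `[0, T]` whose force vanishes from `t₀` on, translated by `t₀ ∈ [0, T)`, is a
classical solution of the UNFORCED system on `[0, T - t₀]` (the system is autonomous; the notion of
solution reads the force only on the time set). [folklore] -/
theorem isClassicalNSSolutionOn_translate_of_silent {ν t₀ T : ℝ}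
    {f u : ℝ → EuclideanSpace ℝ (Fin 3) → EuclideanSpace ℝ (Fin 3)}
    {p : ℝ → EuclideanSpace ℝ (Fin 3) → ℝ}
    (hu : IsClassicalNSSolutionOn (Icc 0 T) ν f u p) (h0 : 0 ≤ t₀) (hT : t₀ < T)
    (hf : ∀ t, t₀ ≤ t → f t = 0) :
    IsClassicalNSSolutionOn (Icc 0 (T - t₀)) ν 0 (fun t => u (t + t₀)) (fun t => p (t + t₀)) := by
  have h1 : IsClassicalNSSolutionOn (Icc 0 (T - t₀)) ν (fun t => f (t + t₀)) (fun t => u (t + t₀))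
      (fun t => p (t + t₀)) :=
    (hu.comp_add_right t₀).mono (fun t ht => ⟨by linarith [ht.1], by linarith [ht.2]⟩)
      (uniqueDiffOn_Icc (by linarith))
  exact h1.congr_force fun t ht x => by simp only [hf (t + t₀) (by linarith [ht.1]), Pi.zero_apply]

/-- **Silent-window uniqueness (Tao 2013, Cor. 11.4 unforced + Lemma 8.1, both theorems of the
tree; no W14).** Let `ν > 0`, `0 ≤ t₁ < t₂ ≤ T`, and let `(u, p)`, `(v, q)` be classical solutions of
the forced Navier–Stokes system on `[0, T] × ℝ³` with the same force `f`, finite energy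
(`sup_{[0,T]} ∫|u|² < ∞`, same for `v`), which AGREE on `[0, t₂]`, and suppose the force is silent
from `t₁` on (`f t = 0` for `t ≥ t₁`). Then `u = v` on `[0, T]`. Proof: `u` restricted to
`[t₁, t₂]` is an unforced finite-energy classical solution, so by the energy class of Lemma 8.1
(`energyClass_of_finiteEnergy`) `∇u(t₀) ∈ L²` for a.e. `t₀ ∈ (t₁, t₂)`; at such a `t₀` both `u` and
`v` restart from the same smooth `H¹` datum `u(t₀) = v(t₀)` with zero force and finite energy, and
Cor. 11.4 (`tao_finite_energy_velocity_uniqueness_holds`) identifies them on `[t₀, T]`.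
[cite: Tao2011, Cor. 11.4] -/
theorem velocity_eq_of_silent_force {ν t₁ t₂ T : ℝ} (hν : 0 < ν) (h1 : 0 ≤ t₁) (h12 : t₁ < t₂)
    (h2T : t₂ ≤ T)
    {f u v : ℝ → EuclideanSpace ℝ (Fin 3) → EuclideanSpace ℝ (Fin 3)}
    {p q : ℝ → EuclideanSpace ℝ (Fin 3) → ℝ}
    (hf : ∀ t, t₁ ≤ t → f t = 0)
    (hu : IsClassicalNSSolutionOn (Icc 0 T) ν f u p)
    (hv : IsClassicalNSSolutionOn (Icc 0 T) ν f v q)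
    (huv : ∀ t ∈ Icc 0 t₂, u t = v t)
    (hEu : ∃ C : ℝ≥0∞, C < ⊤ ∧ ∀ t ∈ Icc 0 T, ∫⁻ x, ‖u t x‖ₑ ^ 2 ≤ C)
    (hEv : ∃ C : ℝ≥0∞, C < ⊤ ∧ ∀ t ∈ Icc 0 T, ∫⁻ x, ‖v t x‖ₑ ^ 2 ≤ C) :
    ∀ t ∈ Icc 0 T, u t = v t := by
  obtain ⟨Cu, hCu, hbu⟩ := hEu
  obtain ⟨Cv, hCv, hbv⟩ := hEv
  -- Step 1: the unforced stretch `[t₁, t₂]` of `u`, translated to `[0, t₂ - t₁]`, has the energy class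
  have h2 : t₁ < T := lt_of_lt_of_le h12 h2T
  have hu12 : IsClassicalNSSolutionOn (Icc 0 (t₂ - t₁)) ν 0 (fun t => u (t + t₁))
      (fun t => p (t + t₁)) :=
    (isClassicalNSSolutionOn_translate_of_silent hu h1 h2 hf).mono
      (Icc_subset_Icc le_rfl (by linarith)) (uniqueDiffOn_Icc (by linarith))
  have hE12 : ∃ A : ℝ≥0∞, A < ⊤ ∧ ∀ t ∈ Icc 0 (t₂ - t₁), ∫⁻ x, ‖u (t + t₁) x‖ₑ ^ 2 ≤ A :=
    ⟨Cu, hCu, fun t ht => hbu (t + t₁) ⟨by linarith [ht.1], by linarith [ht.2]⟩⟩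
  obtain ⟨A, -, -, -, hgrad⟩ := energyClass_of_finiteEnergy hu12 hν (by linarith) hE12
  -- Step 2: a good restarting time `t₀ = τ₀ + t₁ ∈ (t₁, t₂)` with `∇u(t₀) ∈ L²`
  obtain ⟨τ₀, hτ₀, hτ₀fin⟩ := exists_mem_Ioo_lt_top_of_lintegral_lt_top (by linarith) hgrad
  set t₀ : ℝ := τ₀ + t₁ with ht₀def
  have ht₀1 : t₁ < t₀ := by rw [ht₀def]; linarith [hτ₀.1]
  have ht₀2 : t₀ < t₂ := by rw [ht₀def]; linarith [hτ₀.2]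
  have ht₀0 : 0 ≤ t₀ := h1.trans ht₀1.le
  have ht₀T : t₀ < T := lt_of_lt_of_le ht₀2 h2T
  -- the common datum at `t₀`
  have hdat : v t₀ = u t₀ := (huv t₀ ⟨ht₀0, ht₀2.le⟩).symm
  have hw0 : ∫⁻ x, ‖u t₀ x‖ₑ ^ 2 < ⊤ := (hbu t₀ ⟨ht₀0, ht₀T.le⟩).trans_lt hCu
  -- `‖L‖ₑ² ≤ |L|²_F` pointwise (the operator norm is dominated by the Frobenius norm; the landed
  -- `PlaneEnergyCeilingPlanarEnergyLiouville.enorm_sq_le_ofReal_frobeniusNormSq`, inlined to keep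
  -- this module's import closure inside the Palasek chain)
  have hptw : ∀ x, ‖fderiv ℝ (u t₀) x‖ₑ ^ 2 ≤
      ENNReal.ofReal (frobeniusNormSq (fderiv ℝ (u t₀) x)) := fun x => by
    rw [← ofReal_norm, ← ENNReal.ofReal_pow (norm_nonneg _)]
    exact ENNReal.ofReal_le_ofReal (norm_sq_le_frobeniusNormSq _)
  have hw1 : ∫⁻ x, ‖fderiv ℝ (u t₀) x‖ₑ ^ 2 < ⊤ := by
    refine lt_of_le_of_lt (lintegral_mono hptw) ?_
    simpa only [ht₀def] using hτ₀fin
  -- Step 3: restart both solutions at `t₀` (unforced there) and apply Cor. 11.4 (unforced, proved)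
  have hf₀ : ∀ t, t₀ ≤ t → f t = 0 := fun t ht => hf t (ht₀1.le.trans ht)
  have hU : IsClassicalNSSolutionOn (Icc 0 (T - t₀)) ν 0 (fun t => u (t + t₀))
      (fun t => p (t + t₀)) := isClassicalNSSolutionOn_translate_of_silent hu ht₀0 ht₀T hf₀
  have hV : IsClassicalNSSolutionOn (Icc 0 (T - t₀)) ν 0 (fun t => v (t + t₀))
      (fun t => q (t + t₀)) := isClassicalNSSolutionOn_translate_of_silent hv ht₀0 ht₀T hf₀
  have hEU : ∃ C : ℝ≥0∞, C < ⊤ ∧ ∀ t ∈ Icc 0 (T - t₀), ∫⁻ x, ‖u (t + t₀) x‖ₑ ^ 2 ≤ C :=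
    ⟨Cu, hCu, fun t ht => hbu (t + t₀) ⟨by linarith [ht.1], by linarith [ht.2]⟩⟩
  have hEV : ∃ C : ℝ≥0∞, C < ⊤ ∧ ∀ t ∈ Icc 0 (T - t₀), ∫⁻ x, ‖v (t + t₀) x‖ₑ ^ 2 ≤ C :=
    ⟨Cv, hCv, fun t ht => hbv (t + t₀) ⟨by linarith [ht.1], by linarith [ht.2]⟩⟩
  have huniq : ∀ t ∈ Icc 0 (T - t₀), u (t + t₀) = v (t + t₀) :=
    tao_finite_energy_velocity_uniqueness_holds ν (T - t₀) hν (by linarith) (u t₀) hw0 hw1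
      (fun t => u (t + t₀)) (fun t => v (t + t₀)) (fun t => p (t + t₀)) (fun t => q (t + t₀))
      hU hV (by simp only [zero_add]) (by simp only [zero_add, hdat]) hEU hEV
  -- Step 4: read off `[0, T] = [0, t₀] ∪ [t₀, T]`
  intro t ht
  rcases le_or_gt t t₀ with hle | hgt
  · exact huv t ⟨ht.1, hle.trans ht₀2.le⟩
  · have := huniq (t - t₀) ⟨by linarith, by linarith [ht.2]⟩
    simpa only [sub_add_cancel] using this

/-! ## §2 Continuations of a stage past the quiet time are unique -/

namespace Stage

variable {ν : ℝ} {R : TowerRates} {S : Schedule R} {m : Margins R} {k : ℕ}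

/-- **Continuations of a stage of a QUIET schedule are unique (no W14), levels `k ≥ 2`.** For a
quiet schedule (`f ≡ 0` from `τ₁` on), `ν > 0`, a stage at level `k ≥ 2` (any rates, any margin) and
any `T' ≥ τ_k`, two finite-energy classical solutions on `[0, T']` with the schedule's force which
both agree with the stage's velocity on `[0, τ_k]` have the same velocity on `[0, T']`: the silent
stretch `[τ₁, τ_k]` has positive length, and `velocity_eq_of_silent_force` applies.
[cite: Tao2011, Cor. 11.4] -/
theorem continuation_velocity_eq (hν : 0 < ν) (hQ : S.Quiet) (hk : 2 ≤ k) (s : Stage ν R S m k)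
    {T' : ℝ} (hT' : S.τ k ≤ T')
    {u v : ℝ → EuclideanSpace ℝ (Fin 3) → EuclideanSpace ℝ (Fin 3)}
    {p q : ℝ → EuclideanSpace ℝ (Fin 3) → ℝ}
    (hu : IsClassicalNSSolutionOn (Icc 0 T') ν S.f u p)
    (hv : IsClassicalNSSolutionOn (Icc 0 T') ν S.f v q)
    (hua : ∀ t ∈ Icc 0 (S.τ k), u t = s.u t) (hva : ∀ t ∈ Icc 0 (S.τ k), v t = s.u t)
    (hEu : ∃ C : ℝ≥0∞, C < ⊤ ∧ ∀ t ∈ Icc 0 T', ∫⁻ x, ‖u t x‖ₑ ^ 2 ≤ C)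
    (hEv : ∃ C : ℝ≥0∞, C < ⊤ ∧ ∀ t ∈ Icc 0 T', ∫⁻ x, ‖v t x‖ₑ ^ 2 ≤ C) :
    ∀ t ∈ Icc 0 T', u t = v t :=
  velocity_eq_of_silent_force hν (S.τ_pos 1).le (S.τ_strictMono (by omega : 1 < k)) hT' hQ hu hv
    (fun t ht => (hua t ht).trans (hva t ht).symm) hEu hEv

/-- In particular two EXTENSION STAGES of one stage (quiet schedule, level `k ≥ 2`, any margins on
the extensions) carry the same velocity on the whole longer slab `[0, τ_{k+1}]` — unconditionally
(compare `Stage.velocity_eq`, which needs W14 but no quietness). [cite: Tao2011, Cor. 11.4] -/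
theorem extends_velocity_eq (hν : 0 < ν) (hQ : S.Quiet) (hk : 2 ≤ k) (s : Stage ν R S m k)
    {m₁ m₂ : Margins R} (s₁ : Stage ν R S m₁ (k + 1)) (s₂ : Stage ν R S m₂ (k + 1))
    (h₁ : ∀ t ∈ Icc 0 (S.τ k), s₁.u t = s.u t) (h₂ : ∀ t ∈ Icc 0 (S.τ k), s₂.u t = s.u t) :
    ∀ t ∈ Icc 0 (S.τ (k + 1)), s₁.u t = s₂.u t :=
  s.continuation_velocity_eq hν hQ hk (S.τ_mono (Nat.le_succ k)) s₁.classical s₂.classical h₁ h₂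
    s₁.energy s₂.energy

/-- **The `k = 1` corner needs the forced fact.** At ANY level, two finite-energy classical
continuations of a stage with the schedule's force coincide GIVEN Tao's forced unconditional
uniqueness W14 (`tao_unconditional_uniqueness_velocity_forced`): compare from the Clay datum at
`t = 0` (which is `H¹`, `ClayUniqueness.memLp_two_of_rapidDecay`). Recorded so that the first rung
`HeredityAtOne` (hand-over `1 → 2`, comparison window meeting the forced stretch `[0, τ₁)`) has its
transfer lemma too — conditional, unlike `continuation_velocity_eq`. [cite: Tao2011, Cor. 11.4] -/
theorem continuation_velocity_eq_of_forced (hU : tao_unconditional_uniqueness_velocity_forced)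
    (hν : 0 < ν) (s : Stage ν R S m k) {T' : ℝ} (hT' : S.τ k ≤ T')
    {u v : ℝ → EuclideanSpace ℝ (Fin 3) → EuclideanSpace ℝ (Fin 3)}
    {p q : ℝ → EuclideanSpace ℝ (Fin 3) → ℝ}
    (hu : IsClassicalNSSolutionOn (Icc 0 T') ν S.f u p)
    (hv : IsClassicalNSSolutionOn (Icc 0 T') ν S.f v q)
    (hua : ∀ t ∈ Icc 0 (S.τ k), u t = s.u t) (hva : ∀ t ∈ Icc 0 (S.τ k), v t = s.u t)
    (hEu : ∃ C : ℝ≥0∞, C < ⊤ ∧ ∀ t ∈ Icc 0 T', ∫⁻ x, ‖u t x‖ₑ ^ 2 ≤ C)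
    (hEv : ∃ C : ℝ≥0∞, C < ⊤ ∧ ∀ t ∈ Icc 0 T', ∫⁻ x, ‖v t x‖ₑ ^ 2 ≤ C) :
    ∀ t ∈ Icc 0 T', u t = v t := by
  have hτ : 0 < S.τ k := S.τ_pos k
  have h0 : (0 : ℝ) ∈ Icc 0 (S.τ k) := ⟨le_rfl, hτ.le⟩
  have hu0 : u 0 = S.u₀ := (hua 0 h0).trans s.initial
  have hv0 : v 0 = S.u₀ := (hva 0 h0).trans s.initial
  have hC1 : ContDiff ℝ 1 S.u₀ := s.contDiff_datum.of_le (by norm_cast)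
  obtain ⟨hL2, hH1⟩ := Theorems.ClayUniqueness.memLp_two_of_rapidDecay S.datum_decay hC1
  exact hU ν T' hν (lt_of_lt_of_le hτ hT') S.u₀ hL2 hH1 S.f S.force_smooth S.force_decay u v p q
    hu hv hu0 hv0 hEu hEv

end Stage

/-! ## §3 The lower half follows from the crux; the BC3 split is lossless — unconditionally -/

/-- **The lower half IS a consequence of the crux, unconditionally.** Heredity from level `2`
yields `ReadoutFloors`: given a registered stage `s` at level `k ≥ 2` and ANY finite-energy classical
continuation `(u, p)` of it to `τ (k+1)`, the extension stage `s'` provided by heredity is another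
such continuation, so `u = s'.u` on `[0, τ (k+1)]` by silent-window uniqueness
(`Stage.continuation_velocity_eq`; the schedule is quiet and `k ≥ 2`), and the three floors of level
`k + 1` — velocity floor, strain floor, core ledger — are read off `s'` at `τ (k+1)`. The ceiling
hypothesis of `ReadoutFloors` is not even used. [folklore] -/
theorem ReadoutFloors.of_heredityFrom_two (h : HeredityFrom 2) : ReadoutFloors := by
  intro S hP hR hQ k hk s u p hcl hagree henergy _hceil
  obtain ⟨s', hs'⟩ := h S hP hR hQ k hk s
  have heq : ∀ t ∈ Icc 0 (S.τ (k + 1)), u t = s'.u t :=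
    s.continuation_velocity_eq one_pos hQ hk (S.τ_mono (Nat.le_succ k)) hcl s'.classical
      (fun t ht => (hagree t ht).1) (fun t ht => (hs' t ht).1) henergy s'.energy
  have hfin : u (S.τ (k + 1)) = s'.u (S.τ (k + 1)) := heq _ ⟨(S.τ_pos _).le, le_rfl⟩
  rw [hfin]
  exact ⟨s'.floor (k + 1) le_rfl, s'.routeG_strain (k + 1) le_rfl,
    s'.routeG_coreLedger (k + 1) le_rfl⟩

/-- Hence the crux itself yields the readout floors (no named fact). [folklore] -/
theorem EpisodeInductionG.readoutFloors (h : EpisodeInductionG) : ReadoutFloors :=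
  ReadoutFloors.of_heredityFrom_two (h.heredityFrom (by norm_num))

/-- **Heredity from level `2` ⇔ (upper half) ∧ (lower half)** — with no hypothesis: the two
generic-level stubs of the BC3 skeleton are jointly EQUIVALENT to the crux at every level `k ≥ 2`.
[folklore] -/
theorem heredityFrom_two_iff_envelope_and_floors :
    HeredityFrom 2 ↔ ContinuationEnvelope ∧ ReadoutFloors :=
  ⟨fun h => ⟨ContinuationEnvelope.of_heredityFrom_two h, ReadoutFloors.of_heredityFrom_two h⟩,
    fun h => heredityFrom_two_of_envelope_floors h.1 h.2⟩

/-- **The BC3 split of the crux is LOSSLESS, unconditionally**: K2G `EpisodeInductionG` ⇔ (first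
rung `HeredityAtOne`) ∧ (`ContinuationEnvelope`) ∧ (`ReadoutFloors`). So a proof of the two
generic-level stubs is a proof of the crux from level `2` on, and a refutation of either is a
refutation of the crux (not of a mis-split). [folklore] -/
theorem episodeInductionG_iff_rung_envelope_floors :
    EpisodeInductionG ↔ HeredityAtOne ∧ ContinuationEnvelope ∧ ReadoutFloors := by
  rw [episodeInductionG_iff_heredityAtOne_and_heredityFrom_two,
    heredityFrom_two_iff_envelope_and_floors]

/-! ## §4 The lower half may be asked of ONE continuation -/

/-- **An `∃`-form suffices for the lower half.** If every globally anchored registered stage at a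
generic level `k ≥ 2` of a pinned, rigid, quiet schedule has SOME finite-energy classical
continuation to `τ (k+1)` (force `S.f`) meeting the three floors of level `k + 1` at `τ (k+1)` in
the ball — no ceiling asked, nothing asked of other continuations — then `ReadoutFloors` holds: by
`Stage.continuation_velocity_eq` every finite-energy continuation has the same velocity, so the
floors transfer. (The converse direction needs a continuation to exist at all, i.e. the upper half;
under `HeredityFrom 2` both hold.) [folklore] -/
theorem ReadoutFloors.of_exists_continuation
    (h : ∀ S : Schedule TowerRates.wide, S.Pins 8 (6 / 5) → S.Rigid → S.Quiet → ∀ k : ℕ, 2 ≤ k →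
      ∀ s : Stage 1 TowerRates.wide S (Margins.routeG TowerRates.wide) k,
      ∃ (v : ℝ → EuclideanSpace ℝ (Fin 3) → EuclideanSpace ℝ (Fin 3))
        (q : ℝ → EuclideanSpace ℝ (Fin 3) → ℝ),
        IsClassicalNSSolutionOn (Icc 0 (S.τ (k + 1))) 1 S.f v q ∧
        (∀ t ∈ Icc 0 (S.τ k), v t = s.u t) ∧
        (∃ C : ℝ≥0∞, C < ⊤ ∧ ∀ t ∈ Icc 0 (S.τ (k + 1)), ∫⁻ x, ‖v t x‖ₑ ^ 2 ≤ C) ∧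
        (∃ x, ‖x‖ ≤ S.radius ∧ S.c₁ * TowerRates.wide.Y (k + 1) ≤ ‖v (S.τ (k + 1)) x‖) ∧
        (∃ x, ‖x‖ ≤ S.radius ∧
          S.c₁ * TowerRates.wide.A (k + 1) ≤ ‖fderiv ℝ (v (S.τ (k + 1))) x‖) ∧
        (∃ (x : EuclideanSpace ℝ (Fin 3)) (γ : ℝ → EuclideanSpace ℝ (Fin 3)),
          ‖x‖ ≤ S.radius ∧ ContDiff ℝ 1 γ ∧ γ 0 = γ 1 ∧
          (∀ σ ∈ Icc (0 : ℝ) 1, γ σ ∈ Metric.closedBall x (1 / TowerRates.wide.N (k + 1))) ∧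
          (∀ σ ∈ Icc (0 : ℝ) 1, ‖deriv γ σ‖ ≤ 8 * π / TowerRates.wide.N (k + 1)) ∧
          S.c₁ * TowerRates.wide.N (k + 1) ^ (TowerRates.wide.β - 2) ≤
            circulation (v (S.τ (k + 1))) γ)) :
    ReadoutFloors := by
  intro S hP hR hQ k hk s u p hcl hagree henergy _hceil
  obtain ⟨v, q, hv, hva, hEv, hfloor, hstrain, hcore⟩ := h S hP hR hQ k hk s
  have heq : ∀ t ∈ Icc 0 (S.τ (k + 1)), u t = v t :=
    s.continuation_velocity_eq one_pos hQ hk (S.τ_mono (Nat.le_succ k)) hcl hv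
      (fun t ht => (hagree t ht).1) hva henergy hEv
  have hfin : u (S.τ (k + 1)) = v (S.τ (k + 1)) := heq _ ⟨(S.τ_pos _).le, le_rfl⟩
  rw [hfin]
  exact ⟨hfloor, hstrain, hcore⟩

/-- … and conversely heredity from level `2` supplies such a continuation (the extension stage's own
velocity and pressure), so the `∃`-form is, like `ReadoutFloors` itself, a consequence of the crux.
[folklore] -/
theorem HeredityFrom.exists_continuation_with_floors (h : HeredityFrom 2) :
    ∀ S : Schedule TowerRates.wide, S.Pins 8 (6 / 5) → S.Rigid → S.Quiet → ∀ k : ℕ, 2 ≤ k →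
      ∀ s : Stage 1 TowerRates.wide S (Margins.routeG TowerRates.wide) k,
      ∃ (v : ℝ → EuclideanSpace ℝ (Fin 3) → EuclideanSpace ℝ (Fin 3))
        (q : ℝ → EuclideanSpace ℝ (Fin 3) → ℝ),
        IsClassicalNSSolutionOn (Icc 0 (S.τ (k + 1))) 1 S.f v q ∧
        (∀ t ∈ Icc 0 (S.τ k), v t = s.u t) ∧
        (∃ C : ℝ≥0∞, C < ⊤ ∧ ∀ t ∈ Icc 0 (S.τ (k + 1)), ∫⁻ x, ‖v t x‖ₑ ^ 2 ≤ C) ∧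
        (∃ x, ‖x‖ ≤ S.radius ∧ S.c₁ * TowerRates.wide.Y (k + 1) ≤ ‖v (S.τ (k + 1)) x‖) ∧
        (∃ x, ‖x‖ ≤ S.radius ∧
          S.c₁ * TowerRates.wide.A (k + 1) ≤ ‖fderiv ℝ (v (S.τ (k + 1))) x‖) ∧
        (∃ (x : EuclideanSpace ℝ (Fin 3)) (γ : ℝ → EuclideanSpace ℝ (Fin 3)),
          ‖x‖ ≤ S.radius ∧ ContDiff ℝ 1 γ ∧ γ 0 = γ 1 ∧
          (∀ σ ∈ Icc (0 : ℝ) 1, γ σ ∈ Metric.closedBall x (1 / TowerRates.wide.N (k + 1))) ∧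
          (∀ σ ∈ Icc (0 : ℝ) 1, ‖deriv γ σ‖ ≤ 8 * π / TowerRates.wide.N (k + 1)) ∧
          S.c₁ * TowerRates.wide.N (k + 1) ^ (TowerRates.wide.β - 2) ≤
            circulation (v (S.τ (k + 1))) γ) := by
  intro S hP hR hQ k hk s
  obtain ⟨s', hs'⟩ := h S hP hR hQ k hk s
  exact ⟨s'.u, s'.p, s'.classical, fun t ht => (hs' t ht).1, s'.energy, s'.floor (k + 1) le_rfl,
    s'.routeG_strain (k + 1) le_rfl, s'.routeG_coreLedger (k + 1) le_rfl⟩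

/-! ## §5 Numbers: the rigid window in units of the sup-norm scaling time -/

/-- **The growth window in sup-norm scaling units (kernel form of the seat's reading of the upper
half).** Under rigidity the window of level `k + 1` has length `τ (k+1) - τ k = c₅ log N_{k+1} / A_k`
with `c₅ = 4bβ`; measured in the scaling time `ν / (c₂ Y_k)²` of the registered ceiling at unit
viscosity it is `c₂² · 4bβ · log N_{k+1} · N_k^{β-2}` — on the wide rates (`4bβ = 10.12`,
`c₂² = 25/9`, `log N₃ ≈ 7.38`, `N₂^{0.3} ≈ 7.48`) about `1.55·10³` at `k = 2`, and unbounded in `k`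
(`β > 2`). `ContinuationEnvelope` asks for the classical finite-energy continuation of an ARBITRARY
registered stage across this many scaling units (and inside the next ceiling); continuation criteria
of Leray / Prodi–Serrin / Beale–Kato–Majda type control `O(1)` of them. [folklore] -/
theorem Schedule.Rigid.window_mul_ceiling_sq {R : TowerRates} {S : Schedule R} (h : S.Rigid)
    (k : ℕ) :
    (S.τ (k + 1) - S.τ k) * (S.c₂ * R.Y k) ^ 2 =
      S.c₂ ^ 2 * (4 * R.b * R.β) * Real.log (R.N (k + 1)) * R.N k ^ (R.β - 2) := by
  have hN : 0 < R.N k := R.N_pos k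
  have hw : S.τ (k + 1) - S.τ k = S.c₅ * Real.log (R.N (k + 1)) / R.A k := by
    have := h.window_eq k
    linarith
  rw [hw, h.c₅_eq]
  unfold TowerRates.Y TowerRates.A
  have h2 : (R.N k ^ (R.β - 1)) ^ 2 = R.N k ^ R.β * R.N k ^ (R.β - 2) := by
    rw [← Real.rpow_natCast, ← Real.rpow_mul hN.le, ← Real.rpow_add hN]
    congr 1
    push_cast
    ring
  have hA : R.N k ^ R.β ≠ 0 := (Real.rpow_pos_of_pos hN _).ne'
  rw [mul_pow, h2]
  field_simp

end Summit.NavierStokesRegularity.FluidComputer.PalasekTowerClayBridge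

end
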